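import Summits.Ventures.HSemireg.Mod4CarrierTopForm

/-!
# Venture HSemireg — the h-part `Ecl` IS `Σ_m q_m Θ^m/m!`: divided powers of the polarisation 2-vector on the carrier

HONEST FRAMING. Part of the Lean index of the computation cell `pub-hsemireg` (seat w3-mod4-1 gen 8, W3 SPECIAL FIBRES,
MOD4-OFFSPLIT §1 / §13: the dictionary residual of THEOREM R_f on p4's carrier). Finite-dimensional exterior algebra over a
field ONLY: no variety, no cohomology theory, no semiregularity map is constructed here; nothing here says that
HC / HC_CM / HC_AV holds; no Literature fact is declared or used.

WHAT IS PROVED. The carrier's h-part `Ecl bV q N` (`WedgeCarrierEcl.lean`) is DEFINED by the recursion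
`Ecl q (k+1) = Ecl q k + (ℓ_k ∧ m_k) · Ecl (σq) k` and only DOCUMENTED as «`= Σ_m q_m Θ^m/m!` in characteristic `0`». Here that
reading is a theorem. Write `Θ_k := Σ_{j<k} ℓ_j ∧ m_j = Σ_{j<k} LM bV j` and `E_m^{(k)} := Ecl δ_m k` (the `m`-th layer,
`δ_m` the indicator sequence of `m`): (1) `m! · E_m^{(k)} = Θ_k^m` for EVERY field (`factorial_smul_layer_eq_pow`; the `ℓ_j ∧ m_j`
commute and square to zero, so `(Θ_k + ℓ_k ∧ m_k)^{m+1} = Θ_k^{m+1} + (m+1)(ℓ_k ∧ m_k)Θ_k^m`, `pow_succ_add_of_mul_self_eq_zero`);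
(2) `Ecl q k = Σ_{m ≤ k} q_m · E_m^{(k)}` (`Ecl_eq_sum_layer`); hence (3) in characteristic `0`
**`Ecl bV q k = Σ_{m ≤ k} (q_m/m!) · Θ_k^m`** (`Ecl_eq_hPart`) — the h-part is an INTRINSIC function of the polarisation 2-vector
`Θ`, as the geometric dictionary («`f = Σ q_k h^k/k!`») says; and `Θ_N = Σ_{a : Fin N} ℓ_a ∧ m_a` (`ThetaN_eq_sum`).
Everything PROVED, 0 sorry; NO definition is introduced (all sums are written out).
References: [BourbakiAlgebre1a3] Ch. III §7 no. 1 (even elements `x ∧ y` are central, `(x ∧ y)² = 0`).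
-/

noncomputable section

open ExteriorAlgebra (ι)
open Module

namespace Summit.Ventures.HSemireg.WeilFrame

open Summit.Ventures.HSemireg.WedgeBridge Summit.Ventures.HSemireg.WeilCarrier Summit.Ventures.HSemireg.Mod4Carrier

variable {K : Type*} [Field K] {V : Type*} [AddCommGroup V] [Module K V]

/-! ### 1. Two-term binomial formula for a central square-zero increment -/

/-- `(x + y)^{m+1} = x^{m+1} + (m+1) · y x^m` when `y` commutes with `x` and `y² = 0`. [cite: BourbakiAlgebre1a3, Ch. III §7 no. 1] -/
theorem pow_succ_add_of_mul_self_eq_zero {A : Type*} [Ring A] {x y : A} (hc : y * x = x * y) (hy : y * y = 0) :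
    ∀ m : ℕ, (x + y) ^ (m + 1) = x ^ (m + 1) + ((m + 1 : ℕ) : A) * (y * x ^ m)
  | 0 => by rw [zero_add, pow_one, pow_one, pow_zero, mul_one, Nat.cast_one, one_mul]
  | m + 1 => by
    have hcp : ∀ j : ℕ, y * x ^ j = x ^ j * y := fun j => (Commute.pow_right (show Commute y x from hc) j).eq
    have hyy : y * x ^ m * y = 0 := by rw [hcp m, mul_assoc, hy, mul_zero]
    rw [pow_succ, pow_succ_add_of_mul_self_eq_zero hc hy m, add_mul, mul_add, mul_add, ← pow_succ,
      mul_assoc _ (y * x ^ m) x, mul_assoc y (x ^ m) x, ← pow_succ, mul_assoc _ (y * x ^ m) y, hyy, mul_zero, add_zero,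
      ← hcp (m + 1), Nat.cast_succ (m + 1), add_mul, one_mul]
    abel

/-! ### 2. `Θ_k = Σ_{j<k} ℓ_j ∧ m_j`, the layers `E_m^{(k)} = Ecl δ_m k`, and `m! · E_m^{(k)} = Θ_k^m` -/

section Carrier

variable {n : ℕ} (bV : Basis (Fin (n + n)) K V)

/-- `(ℓ_k ∧ m_k)² = 0`. -/
lemma LM_mul_self (k : ℕ) : LM bV k * LM bV k = 0 := by
  have h : ι K (mN bV k) * ι K (ℓN bV k) = -(ι K (ℓN bV k) * ι K (mN bV k)) :=
    eq_neg_of_add_eq_zero_left (ExteriorAlgebra.ι_add_mul_swap _ _)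
  rw [LM, mul_assoc, ← mul_assoc (ι K (mN bV k)), h, neg_mul, mul_neg, mul_assoc, ExteriorAlgebra.ι_sq_zero, mul_zero,
    mul_zero, neg_zero]

/-- the layer recursion `E_{m+1}^{(k+1)} = E_{m+1}^{(k)} + (ℓ_k ∧ m_k) · E_m^{(k)}`. -/
lemma Ecl_delta_succ_succ (m k : ℕ) :
    Ecl bV (fun j => if j = m + 1 then (1 : K) else 0) (k + 1) =
      Ecl bV (fun j => if j = m + 1 then (1 : K) else 0) k + LM bV k * Ecl bV (fun j => if j = m then (1 : K) else 0) k := by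
  have hs : (fun j => if j + 1 = m + 1 then (1 : K) else 0) = fun j => if j = m then (1 : K) else 0 := by
    funext j
    by_cases hj : j = m
    · rw [if_pos hj, if_pos (by rw [hj])]
    · rw [if_neg hj, if_neg (by omega)]
  rw [Ecl, hs]

/-- **`m! · E_m^{(k)} = Θ_k^m`** (every field, every `m, k`): `m! · Ecl δ_m k = (Σ_{j<k} ℓ_j ∧ m_j)^m`.
[cite: BourbakiAlgebre1a3, Ch. III §7 no. 1] -/
theorem factorial_smul_layer_eq_pow :
    ∀ k m : ℕ, ((m.factorial : ℕ) : K) • Ecl bV (fun j => if j = m then (1 : K) else 0) k = (∑ j ∈ Finset.range k, LM bV j) ^ m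
  | 0, 0 => by rw [Nat.factorial_zero, Nat.cast_one, one_smul, Ecl_delta_zero, pow_zero]
  | 0, m + 1 => by
    rw [Ecl, if_neg (by omega), map_zero, smul_zero, Finset.sum_range_zero, zero_pow (by omega)]
  | k + 1, 0 => by rw [Nat.factorial_zero, Nat.cast_one, one_smul, Ecl_delta_zero, pow_zero]
  | k + 1, m + 1 => by
    rw [Ecl_delta_succ_succ, smul_add, factorial_smul_layer_eq_pow k (m + 1), Nat.factorial_succ, Nat.cast_mul, mul_smul,
      ← mul_smul_comm, factorial_smul_layer_eq_pow k m, Finset.sum_range_succ,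
      pow_succ_add_of_mul_self_eq_zero (LM_comm bV k _) (LM_mul_self bV k) m, Nat.cast_smul_eq_nsmul, nsmul_eq_mul]

/-- **`Ecl q k = Σ_{m ≤ k} q_m · E_m^{(k)}`** (every field). [cite: BourbakiAlgebre1a3, Ch. III §7 no. 1] -/
theorem Ecl_eq_sum_layer : ∀ (k : ℕ) (q : ℕ → K),
    Ecl bV q k = ∑ m ∈ Finset.range (k + 1), q m • Ecl bV (fun j => if j = m then (1 : K) else 0) k
  | 0, q => by
    rw [zero_add, Finset.sum_range_one, Ecl_delta_zero, Ecl, Algebra.algebraMap_eq_smul_one]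
  | k + 1, q => by
    have h1 : ∀ m ∈ Finset.range (k + 1), q (m + 1) • Ecl bV (fun j => if j = m + 1 then (1 : K) else 0) (k + 1) =
        q (m + 1) • Ecl bV (fun j => if j = m + 1 then (1 : K) else 0) k +
          LM bV k * (q (m + 1) • Ecl bV (fun j => if j = m then (1 : K) else 0) k) := fun m _ => by
      rw [Ecl_delta_succ_succ, smul_add, mul_smul_comm]
    have h2 : ∑ m ∈ Finset.range (k + 1), q (m + 1) • Ecl bV (fun j => if j = m + 1 then (1 : K) else 0) k =
        ∑ m ∈ Finset.range k, q (m + 1) • Ecl bV (fun j => if j = m + 1 then (1 : K) else 0) k := by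
      rw [Finset.sum_range_succ, Ecl_delta_of_lt bV k (k + 1) (Nat.lt_succ_self k), smul_zero, add_zero]
    have h3 : ∑ m ∈ Finset.range (k + 1), q m • Ecl bV (fun j => if j = m then (1 : K) else 0) k =
        ∑ m ∈ Finset.range k, q (m + 1) • Ecl bV (fun j => if j = m + 1 then (1 : K) else 0) k +
          q 0 • Ecl bV (fun j => if j = 0 then (1 : K) else 0) k :=
      Finset.sum_range_succ' _ _
    have h4 : Ecl bV (fun j => q (j + 1)) k =
        ∑ m ∈ Finset.range (k + 1), q (m + 1) • Ecl bV (fun j => if j = m then (1 : K) else 0) k :=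
      Ecl_eq_sum_layer k _
    rw [Ecl, Ecl_eq_sum_layer k q, h4, Finset.mul_sum,
      Finset.sum_range_succ' (fun m => q m • Ecl bV (fun j => if j = m then (1 : K) else 0) (k + 1)),
      Finset.sum_congr rfl h1, Finset.sum_add_distrib, h2, h3, Ecl_delta_zero, Ecl_delta_zero]
    abel

/-- **the h-part is intrinsic (characteristic `0`):** `Ecl bV q k = Σ_{m ≤ k} (q_m/m!) · Θ_k^m`, `Θ_k = Σ_{j<k} ℓ_j ∧ m_j`.
[cite: BourbakiAlgebre1a3, Ch. III §7 no. 1] -/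
theorem Ecl_eq_hPart [CharZero K] (k : ℕ) (q : ℕ → K) :
    Ecl bV q k = ∑ m ∈ Finset.range (k + 1), (q m * ((m.factorial : ℕ) : K)⁻¹) • (∑ j ∈ Finset.range k, LM bV j) ^ m := by
  rw [Ecl_eq_sum_layer]
  refine Finset.sum_congr rfl fun m _ => ?_
  rw [← factorial_smul_layer_eq_pow, smul_smul, mul_assoc,
    inv_mul_cancel₀ (Nat.cast_ne_zero.mpr (Nat.factorial_ne_zero m)), mul_one]

/-- the full 2-vector `Θ = Θ_N = Σ_{a : Fin N} ℓ_a ∧ m_a` for a basis indexed by `Fin (N + N)`. -/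
theorem ThetaN_eq_sum (N' : ℕ) (bV' : Basis (Fin (N' + N')) K V) :
    ∑ j ∈ Finset.range N', LM bV' j = ∑ a : Fin N', ι K (ℓ bV' a) * ι K (m bV' a) := by
  rw [Finset.sum_range]
  refine Finset.sum_congr rfl fun a _ => ?_
  rw [LM, ℓN, mN, dif_pos a.2, dif_pos a.2]

end Carrier

end Summit.Ventures.HSemireg.WeilFrame

end
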